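import Mathlib
import Literature.AlgebraicGeometry.Resolution.CobordantGame
import Summits.ResolutionOfSingularities.ResolutionOfSingularities.Theorems.WeightedInvariantLocalWeightedDropGradedSliceTameTools

/-!
# `WeightedInvariant.LocalWeightedDrop`: THE TAME SLICE THEOREM — at a tame exceptional point, «slice graded-won with rank
# `α` ⇒ successor graded-won with rank `α`»

Route `ResolutionOfSingularities/WeightedInvariant`, crux `LocalWeightedDrop` (stmt-ResolutionOfSingularities-8899).
[OURS · L1 W4.3] — CHAIN w43 SEAT TABLE v7 row res-type-060 «idea-1's graded slices».  End point of the graded-slice package: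
the probe of idea-1's R3-T3 (`…GradedSliceRank` p507692, `…GradedSliceNoOneMoveWin` p508918 — R3-T3 AS TYPED refuted at a WILD
point) left the one-sided form T3″ standing; its abstract tame form is `…GradedSliceTransfer.gradedWonBy_of_slice_of_trivialization`
(p513479, from the cylinder p511529 / unit p512265 / coordinate-change p512731 transfers); this file EXHIBITS the trivialization at a
TAME exceptional point from res-type-099's orbit identity `wildSlice_pullback` (p500270) and concludes.  Frozen coordinate = the
LAST one (general slot by relabelling, not done).  Nothing here is a statement of the manuscript under review on ladder RESOLUTION;
T3″ is an OURS statement of the graded-game line (ideator res-L1-w43-idea-1); not a verdict on card A.  AI proof, weaker than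
expert review.

* `tameTw` — the scaling `((1 + y_v)·s, y)`; `subst_tameTwInv_tameTw` — undone by `(s·w', y)` with `w'·(1 + y_v) = 1`.
* `subst_tameLambda_eq` — **THE TRIVIALIZATION IDENTITY** `g(Λ) = (1 + y_v)ᵃ · ((g|_{v=0}) ⊗ 1)(tameTw)` from
  `F'(chart_c) = sᵃ·g` (the orbit identity read through `kappa : μ ↦ y_v`, plus `g ≡ (g|_{v=0}) ⊗ 1 mod y_v`).
* `gradedWonBy_of_slice_tame` — **for every field `k`, every lattice `L ⊆ ℤⁿ⁺¹`, weights `w`, point `c` with `c_v ≠ 0 < w_v`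
  and `(w_v : k) ≠ 0` (TAME), every `F'` and every factorisation `F'(chart_c) = sᵃ·g`, and every rank `α`:
  `GradedWonBy α (n+1) (sliceLattice (succLattice L w c) v) (sliceGerm v g) → GradedWonBy α (n+2) (succLattice L w c) g`.**
  With the wild specimen of p508918 (rank `1` slice, rank `0` successor) this brackets the slice statement of the line: at tame
  points the successor is NEVER harder than its slice (same rank), at wild points it can be strictly easier, never the typed «iff».
-/

set_option linter.dupNamespace false -- mandated namespace of this single-conjunct summit
set_option autoImplicit false

namespace Summit.ResolutionOfSingularities.ResolutionOfSingularities.Theorems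

namespace GradedGame

open MvPowerSeries
open Literature.AlgebraicGeometry.Resolution
open Literature.AlgebraicGeometry.Resolution.FormalCoordChange (linMat)

variable {k : Type} [Field k]

section TameAssembly

variable {n : ℕ} (w : Fin (n + 1) → ℕ) (c : Fin (n + 1) → k)

/-- The scaling `Tw = ((1 + y_v)·s, y)` of the exceptional variable. [OURS · L1 W4.3] -/
noncomputable def tameTw (n : ℕ) : Fin (n + 1 + 1) → MvPowerSeries (Fin (n + 1 + 1)) k :=
  Function.update (fun i => (X i : MvPowerSeries (Fin (n + 1 + 1)) k)) 0 ((1 + X (Fin.last (n + 1))) * X 0)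

/-- `Tw` has zero constant terms. [OURS · L1 W4.3] -/
theorem constantCoeff_tameTw (j : Fin (n + 1 + 1)) : constantCoeff (tameTw (k := k) n j) = 0 := by
  unfold tameTw
  by_cases hj : j = 0
  · subst hj; simp [constantCoeff_X]
  · rw [Function.update_of_ne hj]; exact constantCoeff_X j

/-- `sliceR` has zero constant terms. [OURS · L1 W4.3] -/
theorem constantCoeff_sliceR {m : ℕ} (i₀ : Fin m) (i : Fin (m + 1)) : constantCoeff (sliceR (k := k) i₀ i) = 0 := by
  unfold sliceR
  refine Fin.cases ?_ (fun l => ?_) i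
  · simp [constantCoeff_X]
  · simp only [Matrix.cons_val_succ]
    split_ifs <;> simp [constantCoeff_X]

/-- **THE TAME TRIVIALIZATION IDENTITY**: from `F'(chart_c) = sᵃ·g`, reading the orbit identity `wildSlice_pullback` through
`μ ↦ y_v` (`v` = last): `g(Λ) = (1 + y_v)ᵃ · ((g|_{v=0}) ⊗ 1)(Tw)`. [OURS · L1 W4.3] -/
theorem subst_tameLambda_eq (F' : MvPowerSeries (Fin (n + 1)) k) (a : ℕ) (g : MvPowerSeries (Fin (n + 1 + 1)) k)
    (hfac : subst (CobordantGame.cruxChart k w c) F' = X 0 ^ a * g) :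
    subst (tameLambda w c) g = (1 + X (Fin.last (n + 1))) ^ a * subst (tameTw n) (cylinder (sliceGerm (Fin.last n) g)) := by
  have hκ := hasSubst_kappa (k := k) n
  have hκ0 : ∀ i, constantCoeff (kappa (k := k) n i) = 0 := fun i => by
    refine Fin.lastCases ?_ (fun l => ?_) i
    · simp [kappa, constantCoeff_X]
    · simp [kappa, constantCoeff_X]
  have hW := wildSlice_pullback F' w c a g (Fin.last n) hfac
  have h := congrArg (subst (kappa (k := k) n)) hW
  rw [subst_comp_subst_apply (hasSubst_sliceL w c (Fin.last n)) hκ, subst_mul hκ, subst_pow hκ, subst_add hκ, subst_X hκ,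
    subst_comp_subst_apply (hasSubst_sliceR (Fin.last n)) hκ] at h
  have h1 : subst (kappa (k := k) n) (1 : MvPowerSeries (Fin (n + 1 + 1 + 1)) k) = 1 := by
    rw [← coe_substAlgHom hκ, map_one]
  have hlastκ : kappa (k := k) n (Fin.last (n + 1 + 1)) = X (Fin.last (n + 1)) := by simp [kappa]
  rw [h1, hlastκ] at h
  -- `h : subst Λ g = (1 + y_v)^a * subst TwR g`
  set TwR : Fin (n + 1 + 1) → MvPowerSeries (Fin (n + 1 + 1)) k :=
    fun i => subst (kappa (k := k) n) (sliceR (k := k) (Fin.last n) i) with hTwR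
  have hTwR0 : ∀ i, constantCoeff (TwR i) = 0 := fun i => constantCoeff_subst_eq_zero hκ hκ0 (constantCoeff_sliceR _ i)
  have hTwRs : HasSubst TwR := hasSubst_of_constantCoeff_zero hTwR0
  have hTwRL : TwR (Fin.last (n + 1)) = 0 := by
    rw [hTwR, ← Fin.succ_last]
    simp only [sliceR, Matrix.cons_val_succ, ↓reduceIte]
    rw [← coe_substAlgHom hκ, map_zero]
  have hTws : HasSubst (tameTw (k := k) n) := hasSubst_of_constantCoeff_zero (constantCoeff_tameTw (k := k))
  have hE2 : subst TwR g = subst (tameTw n) (cylinder (sliceGerm (Fin.last n) g)) := by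
    rw [subst_eq_subst_cylinder_sliceGerm TwR hTwRs hTwRL g, subst_cylinder hTwRs, subst_cylinder hTws]
    congr 1
    funext j
    refine Fin.cases ?_ (fun l => ?_) j
    · rw [Fin.castSucc_zero]
      simp only [hTwR, sliceR, Matrix.cons_val_zero, tameTw, Function.update_self]
      rw [subst_mul hκ, subst_add hκ, h1, subst_X hκ, subst_X hκ, hlastκ]
      congr 1
    · rw [← Fin.succ_castSucc]
      simp only [hTwR, sliceR, Matrix.cons_val_succ, tameTw]
      rw [if_neg (Fin.castSucc_lt_last l).ne, subst_X hκ, Function.update_of_ne (Fin.succ_ne_zero _)]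
      show kappa n _ = _
      unfold kappa
      rw [Fin.snoc_castSucc]
  rw [← hE2]
  exact h

end TameAssembly

section TameMain

variable {n : ℕ} (w : Fin (n + 1) → ℕ) (c : Fin (n + 1) → k)

/-- The inverse scaling `Tw' = (s·w', y)` with `w'·(1 + y_v) = 1` undoes `Tw`. [OURS · L1 W4.3] -/
theorem subst_tameTwInv_tameTw (w' : MvPowerSeries (Fin (n + 1 + 1)) k) (hw1 : w' * (1 + X (Fin.last (n + 1))) = 1)
    (j : Fin (n + 1 + 1)) :
    subst (Function.update (fun i => (X i : MvPowerSeries (Fin (n + 1 + 1)) k)) 0 (X 0 * w')) (tameTw (k := k) n j) = X j := by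
  have hT0 : ∀ i, constantCoeff (Function.update (fun i => (X i : MvPowerSeries (Fin (n + 1 + 1)) k)) 0 (X 0 * w') i) = 0 := by
    intro i
    by_cases hi : i = 0
    · subst hi; simp [constantCoeff_X]
    · rw [Function.update_of_ne hi]; exact constantCoeff_X i
  have hTs := hasSubst_of_constantCoeff_zero hT0
  have h1 : subst (Function.update (fun i => (X i : MvPowerSeries (Fin (n + 1 + 1)) k)) 0 (X 0 * w'))
      (1 : MvPowerSeries (Fin (n + 1 + 1)) k) = 1 := by
    rw [← coe_substAlgHom hTs, map_one]
  unfold tameTw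
  by_cases hj : j = 0
  · subst hj
    have hL0 : Fin.last (n + 1) ≠ (0 : Fin (n + 1 + 1)) := by
      rw [← Fin.succ_last]; exact Fin.succ_ne_zero _
    rw [Function.update_self, subst_mul hTs, subst_add hTs, h1, subst_X hTs, subst_X hTs, Function.update_self,
      Function.update_of_ne hL0]
    calc (1 + X (Fin.last (n + 1))) * (X 0 * w') = X 0 * (w' * (1 + X (Fin.last (n + 1)))) := by ring
      _ = X 0 := by rw [hw1, mul_one]
  · rw [Function.update_of_ne hj, subst_X hTs, Function.update_of_ne hj]

/-- **THE TAME SLICE THEOREM (frozen coordinate last).**  Let `g` be the `s`-saturated successor of `F'` (e.g. `F' = F(θ)`) at the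
exceptional point `c` of the move with weights `w`: `F'(chart_c) = sᵃ·g`; suppose the LAST old coordinate `v` is translated
(`c_v ≠ 0 < w_v`) and TAME (`p ∤ w_v`, i.e. `(w_v : k) ≠ 0`).  Then, for every lattice `L` and every rank `α`, if the slice
`g|_{y_v = 0}` is won with rank `α` in the graded game of the slice lattice, `g` is won with rank `α` in the graded game of the
propagated lattice `succLattice L w c`: **`GradedWonBy α (n+1) (sliceLattice (succLattice L w c) v) (sliceGerm v g) →
GradedWonBy α (n+2) (succLattice L w c) g`**.  The trivialization is the orbit identity `wildSlice_pullback` (res-type-099,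
p500270) read through `μ ↦ y_v`: `g(Λ) = (1 + y_v)ᵃ · ((g|_{v=0}) ⊗ 1)((1+y_v)s, y)` with `Λ = tameLambda w c` graded of
determinant `w_v c_v`; the transfers are `…GradedSliceTransfer.gradedWonBy_of_slice_of_trivialization`.  This is the TAME half
of the one-sided slice statement T3″ of the graded-game line (idea-1 R3-T3, repaired); at WILD points the rank can shift
(`…GradedSliceNoOneMoveWin`). [OURS · L1 W4.3] -/
theorem gradedWonBy_of_slice_tame (α : Ordinal.{0}) (L : AddSubgroup (Fin (n + 1) → ℤ)) (F' : MvPowerSeries (Fin (n + 1)) k)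
    (a : ℕ) (g : MvPowerSeries (Fin (n + 1 + 1)) k) (hfac : subst (CobordantGame.cruxChart k w c) F' = X 0 ^ a * g)
    (hc : c (Fin.last n) ≠ 0) (hw : 0 < w (Fin.last n)) (htame : ((w (Fin.last n) : ℕ) : k) ≠ 0) :
    GradedWonBy α (n + 1) (sliceLattice (succLattice L w c) (Fin.last n)) (sliceGerm (Fin.last n) g) →
      GradedWonBy α (n + 1 + 1) (succLattice L w c) g := by
  classical
  set L' := succLattice L w c with hL'
  have hgen : ∀ j : Fin (n + 1), c j ≠ 0 → 0 < w j → (Pi.single j.succ 1 : Fin (n + 1 + 1) → ℤ) ∈ L' :=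
    fun j hcj hwj => AddSubgroup.subset_closure (Or.inr ⟨j, hcj, hwj, rfl⟩)
  have hlast : (Pi.single (Fin.last (n + 1)) 1 : Fin (n + 1 + 1) → ℤ) ∈ L' := by
    rw [← Fin.succ_last]; exact hgen _ hc hw
  obtain ⟨w', hw1, hw0, hws⟩ := exists_inv_one_add_X (k := k) (Fin.last (n + 1))
  have hw'deg : ∀ d, coeff d w' ≠ 0 → expVec d - 0 ∈ L' := by
    intro d hd
    obtain ⟨t, rfl⟩ := hws d hd
    rw [expVec_single, sub_zero]
    have : (Pi.single (Fin.last (n + 1)) (t : ℤ) : Fin (n + 1 + 1) → ℤ) = t • (Pi.single (Fin.last (n + 1)) 1 : Fin (n + 1 + 1) → ℤ) := by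
      funext x
      by_cases hx : x = Fin.last (n + 1)
      · subst hx; simp
      · simp [hx]
    rw [this]
    exact L'.nsmul_mem hlast t
  set Tw' : Fin (n + 1 + 1) → MvPowerSeries (Fin (n + 1 + 1)) k :=
    Function.update (fun i => (X i : MvPowerSeries (Fin (n + 1 + 1)) k)) 0 (X 0 * w') with hTw'
  have hTw'0 : ∀ j, constantCoeff (Tw' j) = 0 := by
    intro j
    by_cases hj : j = 0
    · subst hj; simp [hTw', constantCoeff_X]
    · rw [hTw', Function.update_of_ne hj]; exact constantCoeff_X j
  have hTw'det : IsUnit (linMat Tw').det := by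
    change IsUnit (Matrix.of fun i j => coeff (Finsupp.single j 1) (Tw' i)).det
    rw [hTw', linPart_update_X, det_updateRow_one, coeff_single_X_mul, if_pos rfl, hw0]
    exact isUnit_one
  have hTw'gr : ∀ j (e : Fin (n + 1 + 1) →₀ ℕ), coeff e (Tw' j) ≠ 0 → expVec e - Pi.single j 1 ∈ L' := by
    intro j e he
    by_cases hj : j = 0
    · subst hj
      rw [hTw', Function.update_self] at he
      have h := homDeg_mul L' (homDeg_X L' 0) hw'deg e he
      rwa [add_zero] at h
    · rw [hTw', Function.update_of_ne hj] at he
      exact homDeg_X L' j e he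
  have hunit : IsUnit ((1 + X (Fin.last (n + 1))) ^ a : MvPowerSeries (Fin (n + 1 + 1)) k) :=
    (IsUnit.of_mul_eq_one w' (by rw [mul_comm]; exact hw1)).pow a
  have hΛdet : IsUnit (linMat (tameLambda w c)).det := by
    rw [det_linMat_tameLambda]
    exact isUnit_iff_ne_zero.mpr (mul_ne_zero htame hc)
  exact gradedWonBy_of_slice_of_trivialization α L' g hlast (tameLambda w c) (tameTw n) Tw'
    ((1 + X (Fin.last (n + 1))) ^ a) hunit (constantCoeff_tameLambda w c) hΛdet (tameLambda_graded w c L' hlast hgen)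
    (constantCoeff_tameTw) hTw'0 hTw'det hTw'gr (subst_tameTwInv_tameTw w' hw1) (subst_tameLambda_eq w c F' a g hfac)

end TameMain

end GradedGame

end Summit.ResolutionOfSingularities.ResolutionOfSingularities.Theorems
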